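import Summits.QuantumAdvantage.QuantumAdvantage.Theorems.CharDialJLinCore
import Summits.QuantumAdvantage.QuantumAdvantage.Theorems.CharDialJLinGroupFreeze
import Summits.QuantumAdvantage.QuantumAdvantage.Theorems.CharDialUnreadTwist
import Summits.QuantumAdvantage.AdviceFreeQNC0.WalkHardFLinForms
import Summits.QuantumAdvantage.AdviceFreeQNC0.AffBells22WalkHardAllSubcube
import Summits.QuantumAdvantage.AdviceFreeQNC0.BlockCombJoin37
import HarnessLib

/-!
# Cell qa-qnc0 / decomp-qadv (odd primes): the JUNTA-COVER audit and the SLICE split of item 32604 (lens-6 g11, tree-ready twin)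

TREE-READY twin of the node `HOME/decomp-qadv-lens-6/g11/SliceDial.lean` with ZERO `Prop` definitions (every hardness statement
spelled out; predicates as `Finset` data), on top of the landed `CharDialJLinCore` (item 32604 at `p` ⟺ data hardness) and
`CharDialJLinGroupFreeze` (`sparseBits`, `lightGroups`, `gPrivSet`, `privWt`, `tSet`).

* §1 `JLinData.cover` (declare extra unread junta bits: same strategy) and the AUDIT of the read-density split:
  **`pred_of_dense`** — dense-read hardness at ANY density `K` already gives hardness of ALL data with junta budget `log₂ n − 1`
  (cover bit `i` by cut `i`: nothing is non-junta, density is vacuous); **`planted_of_sparse`** — sparse group-core hardness at `K`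
  gives hardness of all budget-`(log₂ n − 1)` data with one uncovered bit of form-degree `∈ [1, n/K]`.
* §2 `JLinData.blindCuts` and the exact SLICE split **`data_iff_rankSplit`**: data hardness ⟺ hardness on RANK-ONE data (all
  non-blind cuts' forms proportional to one vector) ∧ hardness on the complement; CharDial's item and leaf BY NAME
  (`charDial_walkHardFJLinOdd_iff_rankSplit`, `charDial_closes_of_rankSplit`).
* §2⁺ `JLinData`-absorption `absorb` + **`pred_of_rankTwoPlus`** (the DATA-level complement «declared rank ≥ 2» is the target up
  to one junta bit, by junta ABSORPTION of unit vectors) and §2′ the SEMANTIC split **`data_iff_semSplit`** (complement = strategies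
  with NO rank-one presentation in budget; invariant under re-presentation), `charDial_walkHardFJLinOdd_iff_semSplit`, `charDial_closes_of_semSplit`.
* §3 the slicing engine **`rankOne_of_slice`**: per-slice junta hardness on affine `MOD p` hyperplanes ⟹ rank-one hardness.
* §4 W-certificates BY NAME (`rankOne_allBlind` ← `walkHardFJuntaCuts`, `rankOne_noJunta` ← `walkHardFLinForms`, `slice_dirZero`),
  §5 the «own bit ⊕ counter table» family `ownBitCounter` (rank-one, outside every landed rung hypothesis) and `ownBitCounter_of_rankOne`.
-/

set_option linter.dupNamespace false

noncomputable section

namespace Summit.QuantumAdvantage.AdviceFreeQNC0.JLinPeel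

open Finset Summit.QuantumAdvantage.AdviceFreeQNC0 JLinData

variable {p : ℕ} {n : ℕ}

/-! ## §1 The JUNTA-COVER presentation move and the audit of the read-density split -/

/-- Enlarge the junta of every cut `g` by a declared (unread) set `σ g`: the same strategy, presented differently. -/
def cover (D : JLinData p n) (σ : Fin (n + 1) → Finset (Fin n)) : JLinData p n where
  J := fun g => D.J g ∪ σ g
  a := D.a
  h := D.h
  hJ := fun g u v huv s => D.hJ g u v (fun i hi => huv i (mem_union_left _ hi)) s

/-- CharDialJLinSlice helper `cover_strat` (decomp-qadv land package; see the module docstring). -/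
@[simp] theorem cover_strat (D : JLinData p n) (σ : Fin (n + 1) → Finset (Fin n)) : (cover D σ).strat = D.strat := rfl
/-- CharDialJLinSliceA helper `cover_a` (decomp-qadv land package; see the module docstring). -/
@[simp] theorem cover_a (D : JLinData p n) (σ : Fin (n + 1) → Finset (Fin n)) : (cover D σ).a = D.a := rfl
/-- CharDialJLinSliceA helper `cover_h` (decomp-qadv land package; see the module docstring). -/
@[simp] theorem cover_h (D : JLinData p n) (σ : Fin (n + 1) → Finset (Fin n)) : (cover D σ).h = D.h := rfl
/-- CharDialJLinSliceA helper `cover_J` (decomp-qadv land package; see the module docstring). -/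
theorem cover_J (D : JLinData p n) (σ : Fin (n + 1) → Finset (Fin n)) (g : Fin (n + 1)) :
    (cover D σ).J g = D.J g ∪ σ g := rfl

/-- the diagonal cover: cut `g < n` additionally declares bit `g` (except the bits in `E`). -/
def diag (n : ℕ) (E : Finset (Fin n)) : Fin (n + 1) → Finset (Fin n) :=
  fun g => univ.filter fun i : Fin n => i.val = g.val ∧ i ∉ E

/-- CharDialJLinSlice helper `card_diag_le` (decomp-qadv land package; see the module docstring). -/
theorem card_diag_le (E : Finset (Fin n)) (g : Fin (n + 1)) : (diag n E g).card ≤ 1 := by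
  refine card_le_one.2 fun i hi j hj => ?_
  simp only [diag, mem_filter, mem_univ, true_and] at hi hj
  exact Fin.ext (hi.1.trans hj.1.symm)

/-- CharDialJLinSlice helper `mem_diag_self` (decomp-qadv land package; see the module docstring). -/
theorem mem_diag_self {E : Finset (Fin n)} {i : Fin n} (hi : i ∉ E) : i ∈ diag n E ⟨i.val, by omega⟩ := by
  simpa [diag] using hi

/-- CharDialJLinSlice helper `not_mem_diag_of_mem` (decomp-qadv land package; see the module docstring). -/
theorem not_mem_diag_of_mem {E : Finset (Fin n)} {i : Fin n} (hi : i ∈ E) (g : Fin (n + 1)) : i ∉ diag n E g := by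
  simp only [diag, mem_filter, mem_univ, true_and, not_and, not_not]
  exact fun _ => hi

/-- CharDialJLinSlice helper `juntaBound_cover_diag` (decomp-qadv land package; see the module docstring). -/
theorem juntaBound_cover_diag (D : JLinData p n) (E : Finset (Fin n)) (h : ∀ g, (D.J g).card + 1 ≤ Nat.log 2 n)
    (g : Fin (n + 1)) : ((cover D (diag n E)).J g).card ≤ Nat.log 2 n :=
  calc ((cover D (diag n E)).J g).card = (D.J g ∪ diag n E g).card := rfl
    _ ≤ (D.J g).card + (diag n E g).card := card_union_le _ _
    _ ≤ (D.J g).card + 1 := Nat.add_le_add_left (card_diag_le E g) _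
    _ ≤ Nat.log 2 n := h g

/-- After the full diagonal cover every bit is a declared junta bit of some cut. -/
theorem covered_of_not_mem {E : Finset (Fin n)} (D : JLinData p n) {i : Fin n} (hi : i ∉ E) :
    ∃ g, i ∈ (cover D (diag n E)).J g :=
  ⟨⟨i.val, by omega⟩, mem_union_right _ (mem_diag_self hi)⟩

/-- Data hardness gives dense-read hardness at every `K` (trivial direction). -/
theorem dense_of_data [Fact p.Prime] (h : (∃ θ : ℝ, θ < 1 ∧ ∃ n₀ : ℕ, ∀ n ≥ n₀, ∀ (c : ℕ) (D : JLinData p n),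
      (∀ g, (D.J g).card ≤ Nat.log 2 n) → (winCount c D.strat : ℝ) ≤ θ * (2 : ℝ) ^ n)) (K : ℕ) :
    (∃ θ : ℝ, θ < 1 ∧ ∃ n₀ : ℕ, ∀ n ≥ n₀, ∀ (c : ℕ) (D : JLinData p n),
      (∀ g, (D.J g).card ≤ Nat.log 2 n) → D.sparseBits (n / K + 1) = ∅ → (winCount c D.strat : ℝ) ≤ θ * (2 : ℝ) ^ n) := by
  obtain ⟨θ, hθ, n₀, hn₀⟩ := h
  exact ⟨θ, hθ, n₀, fun n hn c D hJ _ => hn₀ n hn c D hJ⟩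

/-- **AUDIT THEOREM 1 (junta cover): dense-read hardness at ANY density `K` already gives hardness of ALL data with junta
budget one less.**  Cover bit `i` by declaring it in the junta of cut `i`: no bit is «non-junta» any more, so `sparseBits R = ∅`
for every `R` — the density hypothesis is VACUOUS on the covered presentation of an arbitrary strategy. -/
theorem pred_of_dense [Fact p.Prime] {K : ℕ} (h : (∃ θ : ℝ, θ < 1 ∧ ∃ n₀ : ℕ, ∀ n ≥ n₀, ∀ (c : ℕ) (D : JLinData p n),
      (∀ g, (D.J g).card ≤ Nat.log 2 n) → D.sparseBits (n / K + 1) = ∅ → (winCount c D.strat : ℝ) ≤ θ * (2 : ℝ) ^ n)) :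
    (∃ θ : ℝ, θ < 1 ∧ ∃ n₀ : ℕ, ∀ n ≥ n₀, ∀ (c : ℕ) (D : JLinData p n),
      (∀ g, (D.J g).card + 1 ≤ Nat.log 2 n) → (winCount c D.strat : ℝ) ≤ θ * (2 : ℝ) ^ n) := by
  obtain ⟨θ, hθ, n₀, hn₀⟩ := h
  refine ⟨θ, hθ, n₀, fun n hn c D hJ => ?_⟩
  have hd : (cover D (diag n ∅)).sparseBits (n / K + 1) = ∅ := by
    refine eq_empty_of_forall_notMem fun i hi => ?_
    rw [mem_sparseBits] at hi
    obtain ⟨g, hg⟩ := covered_of_not_mem D (notMem_empty i)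
    exact hi.1 g hg
  simpa using hn₀ n hn c (cover D (diag n ∅)) (juntaBound_cover_diag D ∅ hJ) hd

/-- **AUDIT THEOREM 2 (junta cover with a hole): g10's piece B at `K` gives planted-bit hardness at `K`.**  Cover every bit
except `i₀`: the only possible group-private bit is `i₀`, so no set of cuts is light at lightness `≥ 2` (the covered data is a
GROUP-CORE vacuously), while `i₀` stays sparse. -/
theorem planted_of_sparse [Fact p.Prime] {K : ℕ} (h : (∀ C' : ℕ, 1 ≤ C' → ∃ θ : ℝ, θ < 1 ∧ ∃ n₀ : ℕ, ∀ n ≥ n₀, ∀ (c : ℕ) (D : JLinData p n),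
      (∀ g, (D.J g).card ≤ Nat.log 2 n) → D.lightGroups (C' * Nat.log 2 n) = ∅ →
        D.sparseBits (n / K + 1) ≠ ∅ → (winCount c D.strat : ℝ) ≤ θ * (2 : ℝ) ^ n)) :
    (∃ θ : ℝ, θ < 1 ∧ ∃ n₀ : ℕ, ∀ n ≥ n₀, ∀ (c : ℕ) (D : JLinData p n),
      (∀ g, (D.J g).card + 1 ≤ Nat.log 2 n) → (∃ i₀ : Fin n, (∀ g, i₀ ∉ D.J g) ∧ (∃ g, D.a g i₀ ≠ 0) ∧
        (univ.filter fun g : Fin (n + 1) => D.a g i₀ ≠ 0).card < n / K + 1) → (winCount c D.strat : ℝ) ≤ θ * (2 : ℝ) ^ n) := by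
  classical
  obtain ⟨θ, hθ, n₀, hn₀⟩ := h 1 le_rfl
  refine ⟨θ, hθ, max n₀ 4, fun n hn c D hJ ⟨i₀, hi₀J, hi₀a, hi₀R⟩ => ?_⟩
  have hn4 : 4 ≤ n := le_trans (le_max_right _ _) hn
  set D' := cover D (diag n {i₀}) with hD'
  have hunc : ∀ g, i₀ ∉ D'.J g := fun g hg => by
    rcases mem_union.1 hg with h1 | h2
    · exact hi₀J g h1
    · exact not_mem_diag_of_mem (mem_singleton_self i₀) g h2
  have hsp : D'.sparseBits (n / K + 1) ≠ ∅ :=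
    nonempty_iff_ne_empty.1 ⟨i₀, (mem_sparseBits D').2 ⟨hunc, hi₀a, hi₀R⟩⟩
  have hL : 2 ≤ 1 * Nat.log 2 n := by
    rw [one_mul]
    exact Nat.le_log_of_pow_le (by norm_num) (by norm_num; omega)
  have hcore : D'.lightGroups (1 * Nat.log 2 n) = ∅ := by
    refine lightGroups_eq_empty_of_forall D' fun G hG => ?_
    rw [mem_lightGroups] at hG
    obtain ⟨⟨g₀, hg₀⟩, -, hwt⟩ := hG
    let t : Fin (n + 1) → ZMod p := fun g => if g = g₀ then 1 else 0
    have ht : t ∈ tSet p G := mem_tSet.2 fun g hg => by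
      simp only [t]
      split_ifs with h
      · exact absurd (h ▸ hg₀) hg
      · rfl
    have ht0 : t ≠ 0 := fun h0 => by
      have := congr_fun h0 g₀
      simp [t] at this
    have h1 := hwt t ht ht0
    have h2 : D'.privWt G t ≤ 1 := by
      calc D'.privWt G t ≤ (D'.gPrivSet G).card := card_filter_le _ _
        _ ≤ ({i₀} : Finset (Fin n)).card := card_le_card fun i hi => ?_
        _ = 1 := card_singleton _
      have hi' : ∀ g', i ∉ D'.J g' := by
        simp only [JLinData.gPrivSet, mem_filter, mem_univ, true_and] at hi
        exact hi.1
      rw [mem_singleton]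
      by_contra hne
      obtain ⟨g, hg⟩ := covered_of_not_mem D (show i ∉ ({i₀} : Finset (Fin n)) by rwa [mem_singleton])
      exact hi' g hg
    have h3 : 1 ≤ G.card := card_pos.2 ⟨g₀, hg₀⟩
    have h4 : 2 * 1 ≤ 1 * Nat.log 2 n * G.card := Nat.mul_le_mul hL h3
    omega
  simpa [hD'] using hn₀ n (le_trans (le_max_left _ _) hn) c D' (juntaBound_cover_diag D {i₀} hJ) hcore hsp

/-! ## §2 The SLICE split: effective rank of the pencil of forms (form-blind cuts exempt) -/

open scoped Classical in
/-- the **form-blind** cuts: those whose table ignores the form value (pure junta players). -/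
def JLinData.blindCuts (D : JLinData p n) : Finset (Fin (n + 1)) :=
  univ.filter fun g => ∀ u s s', D.h g u s = D.h g u s'

/-- CharDialJLinSlice helper `JLinData.mem_blindCuts` (decomp-qadv land package; see the module docstring). -/
theorem JLinData.mem_blindCuts (D : JLinData p n) {g : Fin (n + 1)} : g ∈ D.blindCuts ↔ ∀ u s s', D.h g u s = D.h g u s' := by
  classical
  unfold JLinData.blindCuts
  simp only [mem_filter, mem_univ, true_and]

/-- **The slice split is EXACT**: data hardness ⟺ hardness on RANK-ONE data (the forms of all non-blind cuts are multiples of one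
vector) ∧ hardness on the complement. -/
theorem data_iff_rankSplit [Fact p.Prime] :
    (∃ θ : ℝ, θ < 1 ∧ ∃ n₀ : ℕ, ∀ n ≥ n₀, ∀ (c : ℕ) (D : JLinData p n),
      (∀ g, (D.J g).card ≤ Nat.log 2 n) → (winCount c D.strat : ℝ) ≤ θ * (2 : ℝ) ^ n) ↔
    ((∃ θ : ℝ, θ < 1 ∧ ∃ n₀ : ℕ, ∀ n ≥ n₀, ∀ (c : ℕ) (D : JLinData p n),
      (∀ g, (D.J g).card ≤ Nat.log 2 n) → (∃ a : Fin n → ZMod p, ∀ g, g ∉ D.blindCuts → ∃ l : ZMod p, D.a g = fun i => l * a i) → (winCount c D.strat : ℝ) ≤ θ * (2 : ℝ) ^ n) ∧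
     (∃ θ : ℝ, θ < 1 ∧ ∃ n₀ : ℕ, ∀ n ≥ n₀, ∀ (c : ℕ) (D : JLinData p n),
      (∀ g, (D.J g).card ≤ Nat.log 2 n) → ¬ (∃ a : Fin n → ZMod p, ∀ g, g ∉ D.blindCuts → ∃ l : ZMod p, D.a g = fun i => l * a i) → (winCount c D.strat : ℝ) ≤ θ * (2 : ℝ) ^ n)) := by
  constructor
  · rintro ⟨θ, hθ, n₀, hn₀⟩
    exact ⟨⟨θ, hθ, n₀, fun n hn c D hJ _ => hn₀ n hn c D hJ⟩, ⟨θ, hθ, n₀, fun n hn c D hJ _ => hn₀ n hn c D hJ⟩⟩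
  · rintro ⟨⟨θ₁, hθ₁, n₁, hn₁⟩, ⟨θ₂, hθ₂, n₂, hn₂⟩⟩
    refine ⟨max θ₁ θ₂, max_lt hθ₁ hθ₂, max n₁ n₂, fun n hn c D hJ => ?_⟩
    have h2n : (0 : ℝ) ≤ (2 : ℝ) ^ n := by positivity
    by_cases hr : (∃ a : Fin n → ZMod p, ∀ g, g ∉ D.blindCuts → ∃ l : ZMod p, D.a g = fun i => l * a i)
    · exact (hn₁ n (le_trans (le_max_left _ _) hn) c D hJ hr).trans (mul_le_mul_of_nonneg_right (le_max_left _ _) h2n)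
    · exact (hn₂ n (le_trans (le_max_right _ _) hn) c D hJ hr).trans (mul_le_mul_of_nonneg_right (le_max_right _ _) h2n)

/-- **CharDial's item 32604 ⟺ (rank-one hardness ∧ complement hardness at every prime `p ≥ 5`).** -/
theorem charDial_walkHardFJLinOdd_iff_rankSplit :
    Summit.QuantumAdvantage.QuantumAdvantage.Theses.CharDial.WalkHardFJLinOdd ↔
      (∀ (p : ℕ) [Fact p.Prime], 5 ≤ p →
        (∃ θ : ℝ, θ < 1 ∧ ∃ n₀ : ℕ, ∀ n ≥ n₀, ∀ (c : ℕ) (D : JLinData p n),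
      (∀ g, (D.J g).card ≤ Nat.log 2 n) → (∃ a : Fin n → ZMod p, ∀ g, g ∉ D.blindCuts → ∃ l : ZMod p, D.a g = fun i => l * a i) → (winCount c D.strat : ℝ) ≤ θ * (2 : ℝ) ^ n)) ∧
      (∀ (p : ℕ) [Fact p.Prime], 5 ≤ p →
        (∃ θ : ℝ, θ < 1 ∧ ∃ n₀ : ℕ, ∀ n ≥ n₀, ∀ (c : ℕ) (D : JLinData p n),
      (∀ g, (D.J g).card ≤ Nat.log 2 n) → ¬ (∃ a : Fin n → ZMod p, ∀ g, g ∉ D.blindCuts → ∃ l : ZMod p, D.a g = fun i => l * a i) → (winCount c D.strat : ℝ) ≤ θ * (2 : ℝ) ^ n)) :=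
  ⟨fun h => ⟨fun p _ hp => (data_iff_rankSplit.1 (data_of_pres p (h p hp))).1,
      fun p _ hp => (data_iff_rankSplit.1 (data_of_pres p (h p hp))).2⟩,
    fun h p _ hp => pres_of_data p (data_iff_rankSplit.2 ⟨h.1 p hp, h.2 p hp⟩)⟩

/-- **CharDial's rung leaf from the two slice pieces and the route's other items BY NAME** (`FrobStructureLaw` 32603,
`FrobLiftOdd` 32599, `DegLiftOdd` 32600; via `charDial_closes_of_core`). -/
theorem charDial_closes_of_rankSplit (hL : Summit.QuantumAdvantage.QuantumAdvantage.Theses.CharDial.FrobStructureLaw)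
    (h1 : ∀ (p : ℕ) [Fact p.Prime], 5 ≤ p →
        (∃ θ : ℝ, θ < 1 ∧ ∃ n₀ : ℕ, ∀ n ≥ n₀, ∀ (c : ℕ) (D : JLinData p n),
      (∀ g, (D.J g).card ≤ Nat.log 2 n) → (∃ a : Fin n → ZMod p, ∀ g, g ∉ D.blindCuts → ∃ l : ZMod p, D.a g = fun i => l * a i) → (winCount c D.strat : ℝ) ≤ θ * (2 : ℝ) ^ n))
    (h2 : ∀ (p : ℕ) [Fact p.Prime], 5 ≤ p →
        (∃ θ : ℝ, θ < 1 ∧ ∃ n₀ : ℕ, ∀ n ≥ n₀, ∀ (c : ℕ) (D : JLinData p n),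
      (∀ g, (D.J g).card ≤ Nat.log 2 n) → ¬ (∃ a : Fin n → ZMod p, ∀ g, g ∉ D.blindCuts → ∃ l : ZMod p, D.a g = fun i => l * a i) → (winCount c D.strat : ℝ) ≤ θ * (2 : ℝ) ^ n))
    (hLift : Summit.QuantumAdvantage.QuantumAdvantage.Theses.CharDial.FrobLiftOdd)
    (hD : Summit.QuantumAdvantage.QuantumAdvantage.Theses.CharDial.DegLiftOdd) :
    Summit.QuantumAdvantage.AdviceFreeQNC0.AdviceFreeQNC0Odd :=
  charDial_closes_of_core hL (fun p _ hp => core_of_pres p (charDial_walkHardFJLinOdd_iff_rankSplit.2 ⟨h1, h2⟩ p hp)) hLift hD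

/-! ## §2⁺ JUNTA ABSORPTION: the DATA-level complement is the target in costume (PROVED) -/

section Absorb

/-- a bit as a scalar mod `p`. -/
def bv (b : Bool) : ZMod p := if b then 1 else 0

/-- CharDialJLinSlice helper `bv_true` (decomp-qadv land package; see the module docstring). -/
@[simp] theorem bv_true : (bv true : ZMod p) = 1 := rfl
/-- CharDialJLinSliceA helper `bv_false` (decomp-qadv land package; see the module docstring). -/
@[simp] theorem bv_false : (bv false : ZMod p) = 0 := rfl

/-- the form kept by absorption: the old form of a non-blind cut, `0` for a blind cut (whose table ignores it). -/
def baseForm (D : JLinData p n) (g₀ : Fin (n + 1)) : Fin n → ZMod p := if g₀ ∈ D.blindCuts then 0 else D.a g₀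

/-- **absorption** of the unit vector `e i` into cut `g₀` (strategy-preserving, see `absorb_strat`). -/
def absorb (D : JLinData p n) (g₀ : Fin (n + 1)) (i : Fin n) : JLinData p n where
  J := fun g => if g = g₀ then D.J g ∪ {i} else D.J g
  a := fun g => if g = g₀ then baseForm D g₀ + Pi.single i 1 else D.a g
  h := fun g u s =>
    if g = g₀ then (if g₀ ∈ D.blindCuts then xor (D.h g u 0) (decide (s ≠ bv (u i))) else D.h g u (s - bv (u i)))
    else D.h g u s
  hJ := by
    intro g u v huv s
    by_cases hg : g = g₀
    · subst hg
      simp only [if_true] at huv ⊢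
      have hJ0 : ∀ t, D.h g u t = D.h g v t := fun t => D.hJ g u v (fun j hj => huv j (mem_union_left _ hj)) t
      have hi : u i = v i := huv i (mem_union_right _ (mem_singleton_self i))
      simp only [hJ0, hi]
    · simp only [hg, if_false] at huv ⊢
      exact D.hJ g u v huv s

/-- CharDialJLinSlice helper `absorb_J_self` (decomp-qadv land package; see the module docstring). -/
theorem absorb_J_self (D : JLinData p n) (g₀ : Fin (n + 1)) (i : Fin n) : (absorb D g₀ i).J g₀ = D.J g₀ ∪ {i} := by
  simp [absorb]

/-- CharDialJLinSlice helper `absorb_J_ne` (decomp-qadv land package; see the module docstring). -/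
theorem absorb_J_ne (D : JLinData p n) {g g₀ : Fin (n + 1)} (hg : g ≠ g₀) (i : Fin n) : (absorb D g₀ i).J g = D.J g := by
  simp [absorb, hg]

/-- CharDialJLinSlice helper `absorb_a_self` (decomp-qadv land package; see the module docstring). -/
theorem absorb_a_self (D : JLinData p n) (g₀ : Fin (n + 1)) (i : Fin n) :
    (absorb D g₀ i).a g₀ = baseForm D g₀ + Pi.single i 1 := by
  simp [absorb]

/-- CharDialJLinSlice helper `absorb_a_ne` (decomp-qadv land package; see the module docstring). -/
theorem absorb_a_ne (D : JLinData p n) {g g₀ : Fin (n + 1)} (hg : g ≠ g₀) (i : Fin n) : (absorb D g₀ i).a g = D.a g := by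
  simp [absorb, hg]

/-- CharDialJLinSlice helper `absorb_h_ne` (decomp-qadv land package; see the module docstring). -/
theorem absorb_h_ne (D : JLinData p n) {g g₀ : Fin (n + 1)} (hg : g ≠ g₀) (i : Fin n) : (absorb D g₀ i).h g = D.h g := by
  funext u s
  simp [absorb, hg]

/-- CharDialJLinSlice helper `absorb_blind_ne` (decomp-qadv land package; see the module docstring). -/
theorem absorb_blind_ne (D : JLinData p n) {g g₀ : Fin (n + 1)} (hg : g ≠ g₀) (i : Fin n) :
    g ∈ (absorb D g₀ i).blindCuts ↔ g ∈ D.blindCuts := by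
  rw [JLinData.mem_blindCuts, JLinData.mem_blindCuts, absorb_h_ne D hg i]

/-- the absorbed cut is NOT form-blind (`p ≥ 2`). -/
theorem absorb_not_blind [Fact p.Prime] (D : JLinData p n) (g₀ : Fin (n + 1)) (i : Fin n) :
    g₀ ∉ (absorb D g₀ i).blindCuts := by
  classical
  intro hb0
  have hb' := (JLinData.mem_blindCuts _).1 hb0
  by_cases hb : g₀ ∈ D.blindCuts
  · have h := hb' (fun _ => false) 0 1
    have h1 : (1 : ZMod p) ≠ 0 := one_ne_zero
    simp [absorb, hb, h1] at h
  · apply hb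
    rw [JLinData.mem_blindCuts]
    intro u s s'
    have h := hb' u (s + bv (u i)) (s' + bv (u i))
    simpa [absorb, hb] using h

/-- the form of the absorbed cut: the base form plus the absorbed bit. -/
theorem form_absorb_self (D : JLinData p n) (g₀ : Fin (n + 1)) (i : Fin n) (u : Fin n → Bool) :
    (absorb D g₀ i).form g₀ u = (∑ j, if u j then baseForm D g₀ j else 0) + bv (u i) := by
  classical
  unfold JLinData.form
  rw [absorb_a_self]
  have hsplit : (∑ j, if u j then (baseForm D g₀ + Pi.single i (1 : ZMod p) : Fin n → ZMod p) j else 0)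
      = (∑ j, if u j then baseForm D g₀ j else 0) + ∑ j, if u j then (Pi.single i (1 : ZMod p) : Fin n → ZMod p) j else 0 := by
    rw [← sum_add_distrib]
    exact sum_congr rfl fun j _ => by split_ifs <;> simp
  rw [hsplit]
  congr 1
  rw [sum_eq_single i (fun j _ hj => by simp [Pi.single_eq_of_ne hj]) (by simp)]
  cases u i <;> simp [bv]


end Absorb
end Summit.QuantumAdvantage.AdviceFreeQNC0.JLinPeel
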